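import Summits.ValiantsHypothesis.ValiantsHypothesis.Theorems.LacunarySymmetroidMatrixDescartesVSQDefs

/-!
# `MatrixDescartes` census, `m = 2` row — exponent BOOKKEEPING of the all-`K` «Viro + square splitting» design

HONEST FRAMING.  Integer inequalities only (val-V1-extremal engine seat val-v1x-eng-6 g2) about the design of `…VSQDefs`;
used by `…VSQPoints` / `…VSQLaw` to prove `ζ_sym(2,K) ≥ 4K − 7` for every `K ≥ 4`.  Nothing here mentions the crux
`MatrixDescartes` (stmt-ValiantsHypothesis-18050) or `VP ≠ VNP`.

SCHEDULE (`n = K − 2 ≥ 2`, `x = log_B t`; `ea/eb/ec n v x = h_v + x d_v`): the `a`-chain switches `0 → 1 → ⋯ → n` at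
`x = 0, 2, …, 2n − 2` and is dominant with a unit to spare at `x = −1` (`ea_low_dom`) and `x = 2w − 1` (`ea_blk_dom`); `a_n`
dominates at the `b`-points `x = 2n + 2w − 1` (`ea_n_dom`) and `a_{n+1}` from `x = 4n + 3` on (`ea_top_dom`); the `b`-chain
switches `1 → ⋯ → n` at `x = 2n + 2, …, 4n − 2` (`eb_blk_dom`; `eb_low_le`, `eb_top_le` bound it elsewhere); `c_0` dominates
up to `x = 4n + 3` (`ec_low_dom`), then the `c`-chain alternates (`ec_blk_dom` at `x = 4n + 2w + 3`, `ec_top_dom` at `6n + 5`).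
REGIONS: `ac` beats `b²` by a unit at the `a`- and `c`-points (`gap_low`, `gap_blkA`, `gap_mid`, `gap_blkC`, `gap_top`) and
`b²` beats `ac` at the `b`-points (`gap_W`).  All inequalities were first machine-checked by brute force for `n ≤ 40`
(HOME `pub/val-V1-extremal/eng-6/g2/design_check.py`).
[folklore] Elementary polynomial inequalities.
-/

set_option linter.dupNamespace false
set_option autoImplicit false

namespace Summit.ValiantsHypothesis.ValiantsHypothesis.Theorems.LacunarySymmetroidMatrixDescartes.VSQ

/-! ## 1. Case formulas and small facts -/

/-- the three index regions. [folklore] -/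
theorem cases_v {n v : ℕ} (hv : v ≤ n + 1) : v = 0 ∨ (1 ≤ v ∧ v ≤ n) ∨ v = n + 1 := by omega

/-- `d_0 = 0`. [folklore] -/
theorem dN_zero (n : ℕ) : (dN n 0 : ℤ) = 0 := by simp [dN]
/-- `d_v = n + v` on the block. [folklore] -/
theorem dN_blk {n v : ℕ} (h1 : 1 ≤ v) (h2 : v ≤ n) : (dN n v : ℤ) = n + v := by
  unfold dN; rw [if_neg (by omega), if_pos h2]; push_cast; ring
/-- `d_{n+1} = n² + 5n`. [folklore] -/
theorem dN_top (n : ℕ) : (dN n (n + 1) : ℤ) = (n : ℤ) ^ 2 + 5 * n := by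
  unfold dN; rw [if_neg (by omega), if_neg (by omega)]; push_cast; ring
/-- `h^a_0`. [folklore] -/
theorem haN_zero (n : ℕ) : haN n 0 = qa n := by simp [haN]
/-- `h^a_v` on the block. [folklore] -/
theorem haN_blk {n v : ℕ} (h1 : 1 ≤ v) (h2 : v ≤ n) : haN n v = qa n - ((v : ℤ) - 1) * v := by
  unfold haN; rw [if_neg (by omega), if_pos h2]
/-- `h^a_{n+1}`. [folklore] -/
theorem haN_top (n : ℕ) : haN n (n + 1) = qa n - 4 * (n : ℤ) ^ 3 - 13 * (n : ℤ) ^ 2 + n := by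
  unfold haN; rw [if_neg (by omega), if_neg (by omega)]
/-- `h^c_0`. [folklore] -/
theorem hcN_zero (n : ℕ) : hcN n 0 = 4 * ((n : ℤ) + 1) ^ 2 := by simp [hcN]
/-- `h^c_v` on the block. [folklore] -/
theorem hcN_blk {n v : ℕ} (h1 : 1 ≤ v) (h2 : v ≤ n) :
    hcN n v = -((v : ℤ) - 1) ^ 2 - (4 * (n : ℤ) + 5) * ((v : ℤ) - 1) := by
  unfold hcN; rw [if_neg (by omega), if_pos h2]
/-- `h^c_{n+1}`. [folklore] -/
theorem hcN_top (n : ℕ) : hcN n (n + 1) = -6 * (n : ℤ) ^ 3 - 27 * (n : ℤ) ^ 2 - 11 * n + 4 := by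
  unfold hcN; rw [if_neg (by omega), if_neg (by omega)]
/-- `s^a_0`. [folklore] -/
theorem saR_zero (n : ℕ) : saR n 0 = (-1) ^ n := by simp [saR]
/-- `s^a_v` on the block. [folklore] -/
theorem saR_blk {n v : ℕ} (h1 : 1 ≤ v) (h2 : v ≤ n) : saR n v = (-1) ^ (n + v) := by
  unfold saR; rw [if_neg (by omega), if_pos h2]
/-- `s^a_{n+1} = 1`. [folklore] -/
theorem saR_top (n : ℕ) : saR n (n + 1) = 1 := by
  unfold saR; rw [if_neg (by omega), if_neg (by omega)]
/-- `s^b_v` on the block. [folklore] -/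
theorem sbR_blk {n v : ℕ} (h1 : 1 ≤ v) (h2 : v ≤ n) : sbR n v = (-1) ^ (v + 1) := by
  unfold sbR; rw [if_neg (by omega), if_pos h2]
/-- `s^b` vanishes off the block. [folklore] -/
theorem sbR_off {n v : ℕ} (hv : v = 0 ∨ v = n + 1) : sbR n v = 0 := by
  unfold sbR; split_ifs <;> first | rfl | omega
/-- `s^c_0 = 1`. [folklore] -/
theorem scR_zero (n : ℕ) : scR n 0 = 1 := by simp [scR]
/-- `s^c_v` on the block. [folklore] -/
theorem scR_blk {n v : ℕ} (h1 : 1 ≤ v) (h2 : v ≤ n) : scR n v = (-1) ^ v := by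
  unfold scR; rw [if_neg (by omega), if_pos h2]
/-- `s^c_{n+1}`. [folklore] -/
theorem scR_top (n : ℕ) : scR n (n + 1) = (-1) ^ (n + 1) := by
  unfold scR; rw [if_neg (by omega), if_neg (by omega)]

/-- `|s^a| ≤ 1`. [folklore] -/
theorem abs_saR_le (n v : ℕ) : |saR n v| ≤ 1 := by
  unfold saR; split_ifs <;> simp
/-- `|s^b| ≤ 1`. [folklore] -/
theorem abs_sbR_le (n v : ℕ) : |sbR n v| ≤ 1 := by
  unfold sbR; split_ifs <;> simp
/-- `|s^c| ≤ 1`. [folklore] -/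
theorem abs_scR_le (n v : ℕ) : |scR n v| ≤ 1 := by
  unfold scR; split_ifs <;> simp
/-- `|s^a| = 1`. [folklore] -/
theorem abs_saR_eq (n v : ℕ) : |saR n v| = 1 := by
  unfold saR; split_ifs <;> simp
/-- `|s^c| = 1`. [folklore] -/
theorem abs_scR_eq (n v : ℕ) : |scR n v| = 1 := by
  unfold scR; split_ifs <;> simp
/-- `|s^b_v| = 1` on the block. [folklore] -/
theorem abs_sbR_blk {n v : ℕ} (h1 : 1 ≤ v) (h2 : v ≤ n) : |sbR n v| = 1 := by
  rw [sbR_blk h1 h2]; simp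

/-- distinct integers differ by at least one in square. [folklore] -/
theorem one_le_sq_sub_of_ne {a b : ℤ} (h : a ≠ b) : 1 ≤ (a - b) ^ 2 := by
  have h1 : 1 ≤ |a - b| := Int.one_le_abs (sub_ne_zero.2 h)
  calc (1 : ℤ) = 1 ^ 2 := by norm_num
    _ ≤ |a - b| ^ 2 := pow_le_pow_left₀ (by norm_num) h1 2
    _ = (a - b) ^ 2 := sq_abs _

/-- the support is strictly increasing. [folklore] -/
theorem dN_lt_succ {n v : ℕ} (hn : 1 ≤ n) (hv : v ≤ n) : dN n v < dN n (v + 1) := by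
  have key : (dN n v : ℤ) < dN n (v + 1) := by
    rcases Nat.eq_zero_or_pos v with rfl | hv1
    · rw [dN_zero, dN_blk le_rfl hn]; push_cast; linarith
    · rcases Nat.lt_or_ge v n with hlt | hge
      · rw [dN_blk hv1 hv, dN_blk (by omega) hlt]; push_cast; linarith
      · have hvn : v = n := le_antisymm hv hge
        subst hvn
        rw [dN_blk hv1 le_rfl, dN_top]; nlinarith
  exact_mod_cast key

/-! ## 2. Dominance of single terms (a unit to spare) -/

/-- `x = −1`: `a_0` dominates `a`. [folklore] -/
theorem ea_low_dom {n v : ℕ} (hn : 2 ≤ n) (hv1 : 1 ≤ v) (hv : v ≤ n + 1) :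
    ea n v (-1) + 1 ≤ ea n 0 (-1) := by
  have hn' : (2 : ℤ) ≤ n := by exact_mod_cast hn
  unfold ea
  rcases cases_v hv with h0 | ⟨h1, h2⟩ | htop
  · omega
  · have hv1' : (1 : ℤ) ≤ v := by exact_mod_cast h1
    rw [haN_blk h1 h2, dN_blk h1 h2, haN_zero, dN_zero]
    nlinarith [mul_nonneg (sub_nonneg.2 hv1') (by linarith : (0 : ℤ) ≤ v)]
  · subst htop
    rw [haN_top, dN_top, haN_zero, dN_zero]
    nlinarith [mul_nonneg (mul_nonneg (by linarith : (0 : ℤ) ≤ n) (by linarith : (0 : ℤ) ≤ n))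
      (by linarith : (0 : ℤ) ≤ n)]

/-- `x = 2w − 1` (`1 ≤ w ≤ n`): the block term `a_w` dominates `a`. [folklore] -/
theorem ea_blk_dom {n w v : ℕ} (hn : 2 ≤ n) (hw1 : 1 ≤ w) (hwn : w ≤ n) (hv : v ≤ n + 1) (hvw : v ≠ w) :
    ea n v (2 * w - 1) + 1 ≤ ea n w (2 * w - 1) := by
  have hn' : (2 : ℤ) ≤ n := by exact_mod_cast hn
  have hw1' : (1 : ℤ) ≤ w := by exact_mod_cast hw1
  have hwn' : (w : ℤ) ≤ n := by exact_mod_cast hwn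
  unfold ea
  rw [haN_blk hw1 hwn, dN_blk hw1 hwn]
  rcases cases_v hv with h0 | ⟨h1, h2⟩ | htop
  · subst h0
    rw [haN_zero, dN_zero]
    nlinarith [mul_nonneg (by linarith : (0 : ℤ) ≤ n) (by linarith : (0 : ℤ) ≤ 2 * w - 1)]
  · have hvw' : (v : ℤ) ≠ w := by exact_mod_cast hvw
    have hsq := one_le_sq_sub_of_ne hvw'
    rw [haN_blk h1 h2, dN_blk h1 h2]
    nlinarith
  · subst htop
    rw [haN_top, dN_top]
    nlinarith [mul_nonneg (mul_nonneg (by linarith : (0 : ℤ) ≤ n) (by linarith : (0 : ℤ) ≤ n)) (sub_nonneg.2 hwn'),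
      mul_nonneg (by linarith : (0 : ℤ) ≤ n) (sub_nonneg.2 hwn'),
      mul_nonneg (mul_nonneg (by linarith : (0 : ℤ) ≤ n) (by linarith : (0 : ℤ) ≤ n)) (by linarith : (0 : ℤ) ≤ n),
      sq_nonneg (w : ℤ)]

/-- `x = 2n + 2w − 1` (`1 ≤ w ≤ n`): the block term `a_n` dominates `a`. [folklore] -/
theorem ea_n_dom {n w v : ℕ} (hn : 2 ≤ n) (hw1 : 1 ≤ w) (hwn : w ≤ n) (hv : v ≤ n + 1) (hvn : v ≠ n) :
    ea n v (2 * n + 2 * w - 1) + 1 ≤ ea n n (2 * n + 2 * w - 1) := by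
  have hn' : (2 : ℤ) ≤ n := by exact_mod_cast hn
  have hw1' : (1 : ℤ) ≤ w := by exact_mod_cast hw1
  have hwn' : (w : ℤ) ≤ n := by exact_mod_cast hwn
  have hn1 : 1 ≤ n := by omega
  unfold ea
  rw [haN_blk hn1 le_rfl, dN_blk hn1 le_rfl]
  rcases cases_v hv with h0 | ⟨h1, h2⟩ | htop
  · subst h0
    rw [haN_zero, dN_zero]
    nlinarith [mul_nonneg (by linarith : (0 : ℤ) ≤ n) (by linarith : (0 : ℤ) ≤ w)]
  · have hvn' : (v : ℤ) + 1 ≤ n := by exact_mod_cast (show v + 1 ≤ n by omega)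
    rw [haN_blk h1 h2, dN_blk h1 h2]
    nlinarith [mul_nonneg (by linarith : (0 : ℤ) ≤ n - v - 1) (by linarith : (0 : ℤ) ≤ (n : ℤ) + 2 * w - v - 1)]
  · subst htop
    rw [haN_top, dN_top]
    nlinarith [mul_nonneg (mul_nonneg (by linarith : (0 : ℤ) ≤ n) (by linarith : (0 : ℤ) ≤ n)) (sub_nonneg.2 hwn'),
      mul_nonneg (by linarith : (0 : ℤ) ≤ n) (sub_nonneg.2 hwn')]

/-- `x ≥ 4n + 3`: the top term `a_{n+1}` dominates `a`. [folklore] -/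
theorem ea_top_dom {n v : ℕ} {x : ℤ} (hn : 2 ≤ n) (hv : v ≤ n) (hx : 4 * (n : ℤ) + 3 ≤ x) :
    ea n v x + 1 ≤ ea n (n + 1) x := by
  have hn' : (2 : ℤ) ≤ n := by exact_mod_cast hn
  have hvn' : (v : ℤ) ≤ n := by exact_mod_cast hv
  have hx0 : (0 : ℤ) ≤ x - (4 * n + 3) := by linarith
  unfold ea
  rw [haN_top, dN_top]
  rcases Nat.eq_zero_or_pos v with h0 | h1
  · subst h0
    rw [haN_zero, dN_zero]
    nlinarith [mul_nonneg (by positivity : (0 : ℤ) ≤ (n : ℤ) ^ 2 + 5 * n) hx0]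
  · rw [haN_blk h1 hv, dN_blk h1 hv]
    nlinarith [mul_nonneg (by nlinarith : (0 : ℤ) ≤ (n : ℤ) ^ 2 + 4 * n - v) hx0,
      mul_nonneg (sub_nonneg.2 hvn') (by linarith : (0 : ℤ) ≤ n), sq_nonneg ((n : ℤ) - v)]

/-- `x ≤ 2n + 1`: `b_1` is the largest `b`-term. [folklore] -/
theorem eb_low_le {n v : ℕ} {x : ℤ} (hv1 : 1 ≤ v) (hvn : v ≤ n) (hx : x ≤ 2 * (n : ℤ) + 1) :
    eb n v x ≤ eb n 1 x := by
  have hv1' : (1 : ℤ) ≤ v := by exact_mod_cast hv1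
  unfold eb hbN
  rw [dN_blk hv1 hvn, dN_blk le_rfl (le_trans hv1 hvn)]
  push_cast
  nlinarith [mul_nonneg (sub_nonneg.2 hv1') (by linarith : (0 : ℤ) ≤ v + 2 * n - x)]

/-- `x = 2n + 2w − 1` (`1 ≤ w ≤ n`): the block term `b_w` dominates `b`. [folklore] -/
theorem eb_blk_dom {n w v : ℕ} (hw1 : 1 ≤ w) (hwn : w ≤ n) (hv1 : 1 ≤ v) (hvn : v ≤ n) (hvw : v ≠ w) :
    eb n v (2 * n + 2 * w - 1) + 1 ≤ eb n w (2 * n + 2 * w - 1) := by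
  have hvw' : (v : ℤ) ≠ w := by exact_mod_cast hvw
  have hsq := one_le_sq_sub_of_ne hvw'
  unfold eb hbN
  rw [dN_blk hv1 hvn, dN_blk hw1 hwn]
  nlinarith

/-- `x ≥ 4n − 1`: `b_n` is the largest `b`-term. [folklore] -/
theorem eb_top_le {n v : ℕ} {x : ℤ} (hv1 : 1 ≤ v) (hvn : v ≤ n) (hx : 4 * (n : ℤ) - 1 ≤ x) :
    eb n v x ≤ eb n n x := by
  have hvn' : (v : ℤ) ≤ n := by exact_mod_cast hvn
  unfold eb hbN
  rw [dN_blk hv1 hvn, dN_blk (le_trans hv1 hvn) le_rfl]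
  nlinarith [mul_nonneg (sub_nonneg.2 hvn') (by linarith : (0 : ℤ) ≤ x - 3 * n - v + 1)]

/-- `x ≤ 4n + 3`: `c_0` dominates `c`. [folklore] -/
theorem ec_low_dom {n v : ℕ} {x : ℤ} (hn : 2 ≤ n) (hv1 : 1 ≤ v) (hv : v ≤ n + 1) (hx : x ≤ 4 * (n : ℤ) + 3) :
    ec n v x + 1 ≤ ec n 0 x := by
  have hn' : (2 : ℤ) ≤ n := by exact_mod_cast hn
  have hv1' : (1 : ℤ) ≤ v := by exact_mod_cast hv1
  have hx0 : (0 : ℤ) ≤ 4 * n + 3 - x := by linarith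
  unfold ec
  rw [hcN_zero, dN_zero]
  rcases cases_v hv with h0 | ⟨h1, h2⟩ | htop
  · omega
  · rw [hcN_blk h1 h2, dN_blk h1 h2]
    nlinarith [mul_nonneg (by linarith : (0 : ℤ) ≤ n + v) hx0, sq_nonneg ((v : ℤ) - 1)]
  · subst htop
    rw [hcN_top, dN_top]
    nlinarith [mul_nonneg (by positivity : (0 : ℤ) ≤ (n : ℤ) ^ 2 + 5 * n) hx0,
      mul_nonneg (mul_nonneg (by linarith : (0 : ℤ) ≤ n) (by linarith : (0 : ℤ) ≤ n)) (by linarith : (0 : ℤ) ≤ n)]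

/-- `x = 4n + 2w + 3` (`1 ≤ w ≤ n`): the block term `c_w` dominates `c`. [folklore] -/
theorem ec_blk_dom {n w v : ℕ} (hn : 2 ≤ n) (hw1 : 1 ≤ w) (hwn : w ≤ n) (hv : v ≤ n + 1) (hvw : v ≠ w) :
    ec n v (4 * n + 2 * w + 3) + 1 ≤ ec n w (4 * n + 2 * w + 3) := by
  have hn' : (2 : ℤ) ≤ n := by exact_mod_cast hn
  have hw1' : (1 : ℤ) ≤ w := by exact_mod_cast hw1
  have hwn' : (w : ℤ) ≤ n := by exact_mod_cast hwn
  unfold ec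
  rw [hcN_blk hw1 hwn, dN_blk hw1 hwn]
  rcases cases_v hv with h0 | ⟨h1, h2⟩ | htop
  · subst h0
    rw [hcN_zero, dN_zero]
    nlinarith [mul_nonneg (sub_nonneg.2 hw1') (by linarith : (0 : ℤ) ≤ n), sq_nonneg ((w : ℤ) - 1)]
  · have hvw' : (v : ℤ) ≠ w := by exact_mod_cast hvw
    have hsq := one_le_sq_sub_of_ne hvw'
    rw [hcN_blk h1 h2, dN_blk h1 h2]
    nlinarith
  · subst htop
    rw [hcN_top, dN_top]
    nlinarith [mul_nonneg (mul_nonneg (by linarith : (0 : ℤ) ≤ n) (by linarith : (0 : ℤ) ≤ n)) (sub_nonneg.2 hwn'),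
      mul_nonneg (by linarith : (0 : ℤ) ≤ n) (sub_nonneg.2 hwn'), sq_nonneg ((n : ℤ) - w)]

/-- `x = 6n + 5`: the top term `c_{n+1}` dominates `c`. [folklore] -/
theorem ec_top_dom {n v : ℕ} (hn : 2 ≤ n) (hv : v ≤ n) :
    ec n v (6 * n + 5) + 1 ≤ ec n (n + 1) (6 * n + 5) := by
  have hn' : (2 : ℤ) ≤ n := by exact_mod_cast hn
  have hvn' : (v : ℤ) ≤ n := by exact_mod_cast hv
  unfold ec
  rw [hcN_top, dN_top]
  rcases Nat.eq_zero_or_pos v with h0 | h1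
  · subst h0
    rw [hcN_zero, dN_zero]
    nlinarith
  · rw [hcN_blk h1 hv, dN_blk h1 hv]
    nlinarith [sq_nonneg ((n : ℤ) - v)]

/-! ## 3. Region bookkeeping (`ac` against `b²`, a unit to spare) -/

/-- `x = −1`: `a_0 c_0` beats `b²`. [folklore] -/
theorem gap_low {n : ℕ} (hn : 2 ≤ n) : 2 * eb n 1 (-1) + 1 ≤ ea n 0 (-1) + ec n 0 (-1) := by
  have hn' : (2 : ℤ) ≤ n := by exact_mod_cast hn
  unfold ea eb ec hbN
  rw [haN_zero, hcN_zero, dN_zero, dN_blk le_rfl (by omega : 1 ≤ n)]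
  unfold qa
  push_cast
  nlinarith

/-- `x = 2w − 1` (`1 ≤ w ≤ n`): `a_w c_0` beats `b²`. [folklore] -/
theorem gap_blkA {n w : ℕ} (hw1 : 1 ≤ w) (hwn : w ≤ n) :
    2 * eb n 1 (2 * w - 1) + 1 ≤ ea n w (2 * w - 1) + ec n 0 (2 * w - 1) := by
  have hw1' : (1 : ℤ) ≤ w := by exact_mod_cast hw1
  have hwn' : (w : ℤ) ≤ n := by exact_mod_cast hwn
  unfold ea eb ec hbN
  rw [haN_blk hw1 hwn, hcN_zero, dN_zero, dN_blk hw1 hwn, dN_blk le_rfl (le_trans hw1 hwn)]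
  unfold qa
  push_cast
  nlinarith [mul_nonneg (sub_nonneg.2 hwn') (sub_nonneg.2 hwn')]

/-- `x = 2n + 2w − 1` (`1 ≤ w ≤ n`): `b_w²` beats `ac`. [folklore] -/
theorem gap_W {n w : ℕ} (hn : 2 ≤ n) (hw1 : 1 ≤ w) (hwn : w ≤ n) :
    ea n n (2 * n + 2 * w - 1) + ec n 0 (2 * n + 2 * w - 1) + 1 ≤ 2 * eb n w (2 * n + 2 * w - 1) := by
  have hw1' : (1 : ℤ) ≤ w := by exact_mod_cast hw1
  have hn1 : 1 ≤ n := by omega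
  unfold ea eb ec hbN
  rw [haN_blk hn1 le_rfl, hcN_zero, dN_zero, dN_blk hn1 le_rfl, dN_blk hw1 hwn]
  unfold qa
  nlinarith

/-- `x = 4n + 3`: `a_{n+1} c_0` beats `b²`. [folklore] -/
theorem gap_mid {n : ℕ} (hn : 2 ≤ n) :
    2 * eb n n (4 * n + 3) + 1 ≤ ea n (n + 1) (4 * n + 3) + ec n 0 (4 * n + 3) := by
  have hn' : (2 : ℤ) ≤ n := by exact_mod_cast hn
  have hn1 : 1 ≤ n := by omega
  unfold ea eb ec hbN
  rw [haN_top, hcN_zero, dN_zero, dN_top, dN_blk hn1 le_rfl]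
  unfold qa
  nlinarith

/-- `x = 4n + 2w + 3` (`1 ≤ w ≤ n`): `a_{n+1} c_w` beats `b²`. [folklore] -/
theorem gap_blkC {n w : ℕ} (hn : 2 ≤ n) (hw1 : 1 ≤ w) (hwn : w ≤ n) :
    2 * eb n n (4 * n + 2 * w + 3) + 1 ≤ ea n (n + 1) (4 * n + 2 * w + 3) + ec n w (4 * n + 2 * w + 3) := by
  have hn' : (2 : ℤ) ≤ n := by exact_mod_cast hn
  have hw1' : (1 : ℤ) ≤ w := by exact_mod_cast hw1
  have hn1 : 1 ≤ n := by omega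
  unfold ea eb ec hbN
  rw [haN_top, hcN_blk hw1 hwn, dN_top, dN_blk hw1 hwn, dN_blk hn1 le_rfl]
  unfold qa
  nlinarith [mul_nonneg (mul_nonneg (by linarith : (0 : ℤ) ≤ n) (by linarith : (0 : ℤ) ≤ n)) (by linarith : (0 : ℤ) ≤ w),
    mul_nonneg (by linarith : (0 : ℤ) ≤ n) (by linarith : (0 : ℤ) ≤ w)]

/-- `x = 6n + 5`: `a_{n+1} c_{n+1}` beats `b²`. [folklore] -/
theorem gap_top {n : ℕ} (hn : 2 ≤ n) :
    2 * eb n n (6 * n + 5) + 1 ≤ ea n (n + 1) (6 * n + 5) + ec n (n + 1) (6 * n + 5) := by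
  have hn' : (2 : ℤ) ≤ n := by exact_mod_cast hn
  have hn1 : 1 ≤ n := by omega
  unfold ea eb ec hbN
  rw [haN_top, hcN_top, dN_top, dN_blk hn1 le_rfl]
  unfold qa
  nlinarith [mul_nonneg (mul_nonneg (by linarith : (0 : ℤ) ≤ n) (by linarith : (0 : ℤ) ≤ n)) (by linarith : (0 : ℤ) ≤ n)]

end Summit.ValiantsHypothesis.ValiantsHypothesis.Theorems.LacunarySymmetroidMatrixDescartes.VSQ
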